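import Summits.ResolutionOfSingularities.ResolutionOfSingularities.Theorems.HilbertSamuelEliminationSigmaMaxModificationsCorridor3SigmaTameLowSncStep
import HarnessLib

/-!
# [OURS · L1 W4.2] TAME-LOW row T-L4 «SNC PHASE, lineage-local» — part 3: THE LINEAGE THEOREM — along any lineage of point blow-ups
# through two-dimensional regular local rings of `K`, a configuration of regular branches with distinct members is snc at the
# lineage point from some stage on (finite snc phase), and stays snc
# (cell res-hironaka, LADDER-RESOLUTION rung L; slot W4.2, crux chain w42 `SigmaMaxModificationsCorridor3` stmt-ResolutionOfSingularities-19249 /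
# crux `SigmaMaxModifications` stmt-…-18506; res-L1-w42-plan-1 RULING v3.14-48 (PD)(iv)/(vi)/(PF) row T-L4 → res-L1-w42-stub-4 (gen 7);
# `--supports stmt-ResolutionOfSingularities-19249 --as helper`; consumers: res-D-pv-002 ((TL6) fuel / (γ) SIM instance), res-L1-type-o1
# (`TameLowPrescription`), res-L1-type-o2 (T-L2/T-L6 readings: the lineage as a chain of `IsQuadraticTransform`s))

HONEST FRAMING.  OURS bookkeeping for the TAME-LOW tier (RULING v3.14-48 (PD)(iv)): the assembly of part 2b's step theorem
(`sncDefect_transformAt_lt`, `sncAt_transformAt`) along a LINEAGE, by well-founded induction on `ℕ ×ₗ ℕ`. The singular-branch half of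
the snc phase enters as the ENTRY HYPOTHESIS «at some stage `N₀` every branch through the lineage point is regular» — that half is the
`δ`-drop (`IsQuadraticTransform.curveDelta_lt`, `QuadraticTransformDelta.lean`, PROVED; W4.1's ring-level lineage form
`…SwitchingDichotomy.CurveLineage.eventually_isRegularLocalRing_of_lineage`) once the strict transform of a branch is read as a quadratic
transform of the branch (`QuadraticTransformAlongPrime.range_chartToField_eq_blowupRing`); it is NOT re-proved here. Nothing here is a
statement of H. Hironaka's manuscript [Hironaka2017] (CANDIDATE, never a premise) nor of Cossart–Jannsen–Saito; no named fact; def-free;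
every theorem PROVED. AI-written; weaker than expert review.

THE LINEAGE (all data explicit, no structure): `R : ℕ → Subring K` two-dimensional regular local rings with `R (n+1)` a quadratic
transform of `R n` («the lineage point at stage `n + 1` lies over the lineage point at stage `n`»), chart elements `x n ∈ 𝔪_{R n} ∖ 0`
with `R n [𝔪/x n] ⊆ R (n+1)`, and configurations `B : ℕ → Finset K` propagated by `B (n+1) = transformAt (R (n+1)) (x n) (B n)` (strict
transforms through the new point plus the new exceptional branch — exactly the TAME-LOW snc-phase bookkeeping: member traces,
exceptional traces and the branches of the principal part of `Coeff(J)` are all treated alike).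

* `regular_and_distinct_of_le` — regularity and distinctness of the configuration persist from the entry stage `N₀` on;
* `exists_sncAt_of_le` — from every stage `n ≥ N₀` some later stage is snc (well-founded induction on `sncDefect`);
* `sncAt_of_sncAt_le` — snc persists along the lineage;
* **`eventually_sncAt_of_lineage`** — `∃ N, ∀ n ≥ N, SncAt (R n) (B n)`: THE SNC PHASE IS FINITE LINEAGE-LOCALLY.

References: The Stacks Project, Tags 0BI7, 0BIC [StacksProject]; R. Hartshorne, *Algebraic Geometry*, V Thm. 3.9 [Hartshorne1977];
O. Zariski, P. Samuel II, App. 5 [ZariskiSamuel1960].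
-/

noncomputable section

set_option linter.dupNamespace false -- mandated namespace of this single-conjunct summit

open IsLocalRing Literature.AlgebraicGeometry.Resolution

namespace Summit.ResolutionOfSingularities.ResolutionOfSingularities.Theorems.SigmaMaxModificationsCorridor3.TameLowSnc

universe u

variable {K : Type u} [Field K]

section Lineage

variable {R : ℕ → Subring K} (hreg : ∀ n, IsRegularLocalRing (R n)) (hdim : ∀ n, ringKrullDim (R n) = 2)
  (hq : ∀ n, IsQuadraticTransform (R n) (R (n + 1)))
  {x : ℕ → K} (hx : ∀ n, x n ∈ R n) (hxm : ∀ n, (⟨x n, hx n⟩ : R n) ∈ maximalIdeal (R n)) (hx0 : ∀ n, x n ≠ 0)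
  (hT : ∀ n, blowupRing (R n) (x n) ≤ R (n + 1))
  {B : ℕ → Finset K} (hB : ∀ n, B (n + 1) = transformAt (R (n + 1)) (x n) (B n))

include hreg hdim hq hxm hx0 hT hB

/-- **Regularity and distinctness persist along the lineage**: if at stage `N₀` every branch is regular and any two distinct branches
have finite contact, the same holds at every later stage. [OURS · proved] -/
theorem regular_and_distinct_of_le {N₀ : ℕ} (hreg₀ : ∀ f ∈ B N₀, IsRegularBranch (R N₀) f)
    (hfin₀ : ∀ f ∈ B N₀, ∀ g ∈ B N₀, f ≠ g → contactAt (R N₀) f g ≠ ⊤) {n : ℕ} (hn : N₀ ≤ n) :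
    (∀ f ∈ B n, IsRegularBranch (R n) f) ∧ (∀ f ∈ B n, ∀ g ∈ B n, f ≠ g → contactAt (R n) f g ≠ ⊤) := by
  induction n, hn using Nat.le_induction with
  | base => exact ⟨hreg₀, hfin₀⟩
  | succ n hn ih =>
    haveI := hreg n
    haveI := hreg (n + 1)
    have hx0' : (⟨x n, hx n⟩ : R n) ≠ 0 := fun h => hx0 n (congrArg Subtype.val h)
    rw [hB n]
    exact ⟨isRegularBranch_transformAt (hdim n) (hdim (n + 1)) (hq n) (hxm n) hx0' (hT n) ih.1,
      contactAt_ne_top_transformAt (hdim n) (hdim (n + 1)) (hq n) (hxm n) hx0' (hT n) ih.1 ih.2⟩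

/-- From every stage past the entry stage, **some later stage is snc** (well-founded induction on the snc defect in `ℕ ×ₗ ℕ`,
part 2b `sncDefect_transformAt_lt`). [OURS · proved] -/
theorem exists_sncAt_of_le {N₀ : ℕ} (hreg₀ : ∀ f ∈ B N₀, IsRegularBranch (R N₀) f)
    (hfin₀ : ∀ f ∈ B N₀, ∀ g ∈ B N₀, f ≠ g → contactAt (R N₀) f g ≠ ⊤) {n : ℕ} (hn : N₀ ≤ n) :
    ∃ m, n ≤ m ∧ SncAt (R m) (B m) := by
  suffices H : ∀ (d : ℕ ×ₗ ℕ) (n : ℕ), N₀ ≤ n → sncDefect (R n) (B n) = d → ∃ m, n ≤ m ∧ SncAt (R m) (B m) from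
    H _ n hn rfl
  intro d
  induction d using WellFoundedLT.induction with
  | ind d ih =>
    intro n hn hd
    by_cases hs : SncAt (R n) (B n)
    · exact ⟨n, le_rfl, hs⟩
    · haveI := hreg n
      haveI := hreg (n + 1)
      have hx0' : (⟨x n, hx n⟩ : R n) ≠ 0 := fun h => hx0 n (congrArg Subtype.val h)
      obtain ⟨hregn, hfinn⟩ := regular_and_distinct_of_le hreg hdim hq hx hxm hx0 hT hB hreg₀ hfin₀ hn
      have hlt := sncDefect_transformAt_lt (hdim n) (hdim (n + 1)) (hq n) (hxm n) hx0' (hT n) hregn hfinn hs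
      rw [← hB n, hd] at hlt
      obtain ⟨m, hm, hsm⟩ := ih _ hlt (n + 1) (by omega) rfl
      exact ⟨m, by omega, hsm⟩

/-- **Snc persists along the lineage** (part 2b `sncAt_transformAt`). [OURS · proved] -/
theorem sncAt_of_sncAt_le {m : ℕ} (hsm : SncAt (R m) (B m)) {n : ℕ} (hn : m ≤ n) : SncAt (R n) (B n) := by
  induction n, hn using Nat.le_induction with
  | base => exact hsm
  | succ n hn ih =>
    haveI := hreg n
    haveI := hreg (n + 1)
    have hx0' : (⟨x n, hx n⟩ : R n) ≠ 0 := fun h => hx0 n (congrArg Subtype.val h)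
    rw [hB n]
    exact sncAt_transformAt (hdim n) (hdim (n + 1)) (hq n) (hxm n) hx0' (hT n) ih

/-- **THE LINEAGE THEOREM — the snc phase is finite lineage-locally.**  Along a lineage `R 0 → R 1 → ⋯` of point blow-ups through
two-dimensional regular local rings of `K` (each `R (n+1)` a quadratic transform of `R n` in the chart of `x n`), with the branch
configurations propagated by strict transform plus exceptional branch (`B (n+1) = transformAt (R (n+1)) (x n) (B n)`): if at some
stage `N₀` every branch through the lineage point is regular and distinct branches have finite contact (the output of the
singular-branch half), then **from some stage on the configuration is snc at the lineage point**. [OURS · proved; classical embedded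
resolution of plane curve configurations, The Stacks Project Tag 0BIC / Hartshorne V.3.9, in lineage-local form] -/
theorem eventually_sncAt_of_lineage {N₀ : ℕ} (hreg₀ : ∀ f ∈ B N₀, IsRegularBranch (R N₀) f)
    (hfin₀ : ∀ f ∈ B N₀, ∀ g ∈ B N₀, f ≠ g → contactAt (R N₀) f g ≠ ⊤) :
    ∃ N, ∀ n, N ≤ n → SncAt (R n) (B n) := by
  obtain ⟨m, -, hsm⟩ := exists_sncAt_of_le hreg hdim hq hx hxm hx0 hT hB hreg₀ hfin₀ le_rfl
  exact ⟨m, fun n hn => sncAt_of_sncAt_le hreg hdim hq hx hxm hx0 hT hB hsm hn⟩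

end Lineage

end Summit.ResolutionOfSingularities.ResolutionOfSingularities.Theorems.SigmaMaxModificationsCorridor3.TameLowSnc

end
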